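import Mathlib
import Summits.Ventures.PercRepro2.Defs
import Summits.Ventures.PercRepro2.Independence
import Summits.Ventures.PercRepro2.Harris
import Summits.Ventures.PercRepro2.Graph
import Summits.Ventures.PercRepro2.FourFunctions
import Summits.Ventures.PercRepro2.OneEdge
import Summits.Ventures.PercRepro2.XWForm
import Summits.Ventures.PercRepro2.XWEdgeSY

/-!
# (XW) is concave in the weight of a `u–o` edge: the `u–o` edge is removable (PercRepro2, p2 g26)

`XW(p) = xwBil p p = P(aλ) + P(Sa)P(Sλ) − P(a)P(λ) − P(S)P(Saλ)` with `a = {s ↔ u}`,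
`λ = {y ↔ o}`, `S = {s ↔ y}` (XWForm.lean); write `h = {s ↔ o}`, `b = {y ↔ u}`, `Q = Sᶜ`.  Let `e`
be an edge with ends `{u, o}` and `t = p e`.  Forcing `e` open turns `a`, `λ`, `S` into
`A = a ∪ h`, `L = λ ∪ b`, `S₁ = S ∪ (a ∩ λ) ∪ (h ∩ b)` (`OneEdge.conn_update_true_iff`) — the
`u = o` coincidence, for which `XW(p[e↦1]) ≥ 0` by the four functions theorem exactly as in
`XWCoincideUO.lean` (`xwBil_update_one_nonneg`).  In XWEdgeUOIdentity.lean the one-edge Bernstein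
expansion `xxwBil_bernstein` then reads

  `XW(p) = (1 − t)·XW(p[e↦0]) + t·XW(p[e↦1]) + t(1 − t)·D_uo(p[e↦0])`      (`xwBil_eq_uo_edge`)

with the concavity defect **`D_uo = P(h ∩ aᶜ)·P(b ∩ λᶜ) − P(S ∩ a ∩ λᶜ)·P(S ∩ aᶜ ∩ λ)`** (`dUO`),
which is a SUM OF PRODUCTS OF PROBABILITIES:

  `D_uo = P(S ∩ aᶜ ∩ λ)·P(Q ∩ b ∩ λᶜ) + P(Q ∩ h ∩ aᶜ)·P(S ∩ a ∩ λᶜ) + P(Q ∩ h ∩ aᶜ)·P(Q ∩ b ∩ λᶜ)`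

(`dUO_eq_sum`), hence `0 ≤ D_uo` (`dUO_nonneg`, the conjecture (C-uo) of record P2-G25-XWSTRUCT.md
§9 is a theorem) and `xwBil_nonneg_of_uo_edge`: the `u–o` edge can be deleted without loss.  This
file holds the events `A`, `L`, `S₁`, their structure, and the forced-open form.  Own work;
standard axioms.
-/

namespace Summit.Ventures.PercRepro2

namespace XWEdgeUO

variable {V : Type*} {E : Type*} [Fintype E] [DecidableEq E] {R : Type*} [CommRing R]

variable (ends : E → Sym2 V) (s y o u : V)

/-- `A = {s ↔ u} ∪ {s ↔ o}`: `s` is connected to the pair `{u, o}`. -/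
def A : Set (Config E) := connEvent ends s u ∪ connEvent ends s o

/-- `L = {y ↔ o} ∪ {y ↔ u}`: `y` is connected to the pair `{u, o}`. -/
def L : Set (Config E) := connEvent ends y o ∪ connEvent ends y u

/-- `S₁ = {s ↔ y} ∪ ({s ↔ u} ∩ {y ↔ o}) ∪ ({s ↔ o} ∩ {y ↔ u})`: `s ↔ y` once `u` and `o` are merged. -/
def S1 : Set (Config E) :=
  connEvent ends s y ∪ (connEvent ends s u ∩ connEvent ends y o) ∪
    (connEvent ends s o ∩ connEvent ends y u)

variable {ends s y o u}

omit [Fintype E] in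
/-- With `e = {u, o}` forced open, `{s ↔ u}` is `A`. -/
lemma preimage_a {e : E} (he : ends e = s(u, o)) :
    {ω : Config E | Function.update ω e true ∈ connEvent ends s u} = A ends s o u := by
  ext ω
  simp only [Set.mem_setOf_eq, mem_connEvent, A, Set.mem_union]
  rw [OneEdge.conn_update_true_iff he]
  constructor
  · rintro (h | ⟨h, _⟩ | ⟨h, _⟩)
    · exact Or.inl h
    · exact Or.inl h
    · exact Or.inr h
  · rintro (h | h)
    · exact Or.inl h
    · exact Or.inr (Or.inr ⟨h, conn_refl ends ω u⟩)

omit [Fintype E] in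
/-- With `e = {u, o}` forced open, `{y ↔ o}` is `L`. -/
lemma preimage_l {e : E} (he : ends e = s(u, o)) :
    {ω : Config E | Function.update ω e true ∈ connEvent ends y o} = L ends y o u := by
  ext ω
  simp only [Set.mem_setOf_eq, mem_connEvent, L, Set.mem_union]
  rw [OneEdge.conn_update_true_iff he]
  constructor
  · rintro (h | ⟨h, _⟩ | ⟨h, _⟩)
    · exact Or.inl h
    · exact Or.inr h
    · exact Or.inl h
  · rintro (h | h)
    · exact Or.inl h
    · exact Or.inr (Or.inl ⟨h, conn_refl ends ω o⟩)

omit [Fintype E] in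
/-- With `e = {u, o}` forced open, `{s ↔ y}` is `S₁`. -/
lemma preimage_S {e : E} (he : ends e = s(u, o)) :
    {ω : Config E | Function.update ω e true ∈ connEvent ends s y} = S1 ends s y o u := by
  ext ω
  simp only [Set.mem_setOf_eq, mem_connEvent, S1, Set.mem_union, Set.mem_inter_iff]
  rw [OneEdge.conn_update_true_iff he]
  constructor
  · rintro (h | ⟨h1, h2⟩ | ⟨h1, h2⟩)
    · exact Or.inl (Or.inl h)
    · exact Or.inl (Or.inr ⟨h1, conn_symm h2⟩)
    · exact Or.inr ⟨h1, conn_symm h2⟩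
  · rintro ((h | ⟨h1, h2⟩) | ⟨h1, h2⟩)
    · exact Or.inl h
    · exact Or.inr (Or.inl ⟨h1, conn_symm h2⟩)
    · exact Or.inr (Or.inr ⟨h1, conn_symm h2⟩)

/-! ## Structure of `A`, `L`, `S₁` -/

omit [Fintype E] [DecidableEq E] in
/-- `A` is increasing. -/
lemma isUpperSet_A : IsUpperSet (A ends s o u) :=
  (isUpperSet_connEvent ends s u).union (isUpperSet_connEvent ends s o)

omit [Fintype E] [DecidableEq E] in
/-- `L` is increasing. -/
lemma isUpperSet_L : IsUpperSet (L ends y o u) :=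
  (isUpperSet_connEvent ends y o).union (isUpperSet_connEvent ends y u)

omit [Fintype E] [DecidableEq E] in
/-- `S₁` is increasing. -/
lemma isUpperSet_S1 : IsUpperSet (S1 ends s y o u) :=
  ((isUpperSet_connEvent ends s y).union
    ((isUpperSet_connEvent ends s u).inter (isUpperSet_connEvent ends y o))).union
    ((isUpperSet_connEvent ends s o).inter (isUpperSet_connEvent ends y u))

omit [Fintype E] [DecidableEq E] in
/-- `S₁ ∩ A ⊆ L`: once `s ↔ y` and `s` reaches the merged pair, so does `y`. -/
lemma S1_inter_A_subset : S1 ends s y o u ∩ A ends s o u ⊆ L ends y o u := by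
  rintro ω ⟨hS, hA⟩
  simp only [S1, A, L, Set.mem_union, Set.mem_inter_iff, mem_connEvent] at hS hA ⊢
  rcases hS with (hsy | ⟨hsu, hyo⟩) | ⟨hso, hyu⟩
  · rcases hA with hsu | hso
    · exact Or.inr (conn_trans (conn_symm hsy) hsu)
    · exact Or.inl (conn_trans (conn_symm hsy) hso)
  · exact Or.inl hyo
  · exact Or.inr hyu

omit [Fintype E] [DecidableEq E] in
/-- `S₁ ∩ L ⊆ A`. -/
lemma S1_inter_L_subset : S1 ends s y o u ∩ L ends y o u ⊆ A ends s o u := by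
  rintro ω ⟨hS, hL⟩
  simp only [S1, A, L, Set.mem_union, Set.mem_inter_iff, mem_connEvent] at hS hL ⊢
  rcases hS with (hsy | ⟨hsu, hyo⟩) | ⟨hso, hyu⟩
  · rcases hL with hyo | hyu
    · exact Or.inr (conn_trans hsy hyo)
    · exact Or.inl (conn_trans hsy hyu)
  · exact Or.inl hsu
  · exact Or.inr hso

omit [Fintype E] [DecidableEq E] in
/-- `A ∩ L ⊆ S₁`. -/
lemma A_inter_L_subset : A ends s o u ∩ L ends y o u ⊆ S1 ends s y o u := by
  rintro ω ⟨hA, hL⟩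
  simp only [S1, A, L, Set.mem_union, Set.mem_inter_iff, mem_connEvent] at hA hL ⊢
  rcases hA with hsu | hso <;> rcases hL with hyo | hyu
  · exact Or.inl (Or.inr ⟨hsu, hyo⟩)
  · exact Or.inl (Or.inl (conn_trans hsu (conn_symm hyu)))
  · exact Or.inl (Or.inl (conn_trans hso (conn_symm hyo)))
  · exact Or.inr ⟨hso, hyu⟩

omit [Fintype E] [DecidableEq E] in
/-- `S₁ ∩ A = A ∩ L`. -/
lemma S1_inter_A_eq : S1 ends s y o u ∩ A ends s o u = A ends s o u ∩ L ends y o u := by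
  apply Set.Subset.antisymm
  · intro ω hω
    exact ⟨hω.2, S1_inter_A_subset hω⟩
  · intro ω hω
    exact ⟨A_inter_L_subset hω, hω.1⟩

omit [Fintype E] [DecidableEq E] in
/-- `S₁ ∩ L = A ∩ L`. -/
lemma S1_inter_L_eq : S1 ends s y o u ∩ L ends y o u = A ends s o u ∩ L ends y o u := by
  apply Set.Subset.antisymm
  · intro ω hω
    exact ⟨S1_inter_L_subset hω, hω.2⟩
  · intro ω hω
    exact ⟨A_inter_L_subset hω, hω.2⟩

/-! ## The forced-open form is the `u = o` coincidence: nonnegative by the four functions theorem -/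

variable (ends s y o u) in
/-- `B(p₁, p₁) = P(F) + P(F)² − P(A)P(L) − P(S₁)P(F)` with `F = A ∩ L` (all under `p[e↦0]`). -/
theorem xwBil_update_one_eq (p : E → R) {e : E} (he : ends e = s(u, o)) :
    xwBil ends s y o u (Function.update p e 1) (Function.update p e 1) =
      prob (Function.update p e 0) (A ends s o u ∩ L ends y o u) +
        prob (Function.update p e 0) (A ends s o u ∩ L ends y o u) *
          prob (Function.update p e 0) (A ends s o u ∩ L ends y o u) -
        prob (Function.update p e 0) (A ends s o u) * prob (Function.update p e 0) (L ends y o u) -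
        prob (Function.update p e 0) (S1 ends s y o u) *
          prob (Function.update p e 0) (A ends s o u ∩ L ends y o u) := by
  unfold xwBil
  simp only [XWEdgeSY.prob_update_one_eq_update_zero_preimage p e, XWEdgeSY.preimage_inter,
    preimage_S (s := s) (y := y) he, preimage_a (s := s) he, preimage_l (y := y) he]
  rw [S1_inter_A_eq, S1_inter_L_eq, Set.inter_assoc, Set.inter_self]

omit [Fintype E] [DecidableEq E] in
/-- **The four-functions input**: `ω ∈ A ∖ L`, `ω' ∈ L ∖ A` force `ω ⊔ ω' ∈ A ∩ L` and
`ω ⊓ ω' ∉ S₁ ∪ A ∪ L`. -/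
lemma sup_inf_of_mem :
    ∀ ω ∈ A ends s o u ∩ (L ends y o u)ᶜ, ∀ ω' ∈ L ends y o u ∩ (A ends s o u)ᶜ,
      ω ⊔ ω' ∈ A ends s o u ∩ L ends y o u ∧
        ω ⊓ ω' ∈ (S1 ends s y o u)ᶜ ∩ (A ends s o u)ᶜ ∩ (L ends y o u)ᶜ := by
  rintro ω ⟨hA, hL⟩ ω' ⟨hL', hA'⟩
  refine ⟨⟨isUpperSet_A le_sup_left hA, isUpperSet_L le_sup_right hL'⟩, ⟨⟨?_, ?_⟩, ?_⟩⟩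
  · intro hS
    have hS' : ω ∈ S1 ends s y o u := isUpperSet_S1 inf_le_left hS
    exact hL (S1_inter_A_subset ⟨hS', hA⟩)
  · intro h
    exact hA' (isUpperSet_A inf_le_right h)
  · intro h
    exact hL (isUpperSet_L inf_le_left h)

variable (ends s y o u) in
/-- **The forced-open form is nonnegative** (the `u = o` coincidence of (XW), by the four functions
theorem as in `XWCoincideUO.lean`): `0 ≤ XW(p[e↦1])` for an edge `e = {u, o}`. -/
theorem xwBil_update_one_nonneg [LinearOrder R] [IsStrictOrderedRing R] {p : E → R}
    (hp : IsProbVec p) {e : E} (he : ends e = s(u, o)) :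
    0 ≤ xwBil ends s y o u (Function.update p e 1) (Function.update p e 1) := by
  rw [xwBil_update_one_eq ends s y o u p he]
  set q := Function.update p e 0 with hq
  have hq' : IsProbVec q := hp.update e (le_refl 0) zero_le_one
  set Aset := A ends s o u with hA
  set Lset := L ends y o u with hL
  set Sset := S1 ends s y o u with hS
  set F := Aset ∩ Lset with hF
  -- split `A` and `L` along `F`
  have h1 : prob q (Aset ∩ Lset) + prob q (Aset ∩ Lsetᶜ) = prob q Aset :=
    prob_inter_add_prob_inter_compl q Aset Lset
  have h2 : prob q (Lset ∩ Aset) + prob q (Lset ∩ Asetᶜ) = prob q Lset :=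
    prob_inter_add_prob_inter_compl q Lset Aset
  rw [Set.inter_comm Lset Aset] at h2
  set A₁ := Aset ∩ Lsetᶜ with hA₁
  set B₁ := Lset ∩ Asetᶜ with hB₁
  set D₀ := Ssetᶜ ∩ Asetᶜ ∩ Lsetᶜ with hD₀
  have hdisj1 : Disjoint A₁ B₁ := by
    rw [Set.disjoint_left]
    rintro ω ⟨hω, _⟩ ⟨_, hω'⟩
    exact hω' hω
  have hdisj2 : Disjoint (A₁ ∪ B₁) D₀ := by
    rw [Set.disjoint_left]
    rintro ω (⟨hω, _⟩ | ⟨hω, _⟩) ⟨⟨_, hω'⟩, hω''⟩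
    · exact hω' hω
    · exact hω'' hω
  have hsub : A₁ ∪ B₁ ∪ D₀ ⊆ Ssetᶜ := by
    rintro ω ((⟨hAω, hLω⟩ | ⟨hLω, hAω⟩) | ⟨⟨hQ, _⟩, _⟩)
    · intro hSω
      exact hLω (S1_inter_A_subset ⟨hSω, hAω⟩)
    · intro hSω
      exact hAω (S1_inter_L_subset ⟨hSω, hLω⟩)
    · exact hQ
  have hQ : prob q A₁ + prob q B₁ + prob q D₀ ≤ prob q Ssetᶜ := by
    rw [← prob_union_of_disjoint q hdisj1, ← prob_union_of_disjoint q hdisj2]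
    exact prob_mono hq' hsub
  have hAD : prob q A₁ * prob q B₁ ≤ prob q F * prob q D₀ :=
    prob_mul_prob_le_of_sup_inf hq' sup_inf_of_mem
  have hc : prob q Ssetᶜ = 1 - prob q Sset := prob_compl q Sset
  have hF0 : 0 ≤ prob q F := prob_nonneg hq' F
  have hD0 : 0 ≤ prob q D₀ := prob_nonneg hq' D₀
  have hkey : 0 ≤ prob q F * (prob q Ssetᶜ - prob q A₁ - prob q B₁ - prob q D₀) :=
    mul_nonneg hF0 (by linarith)
  rw [← h1, ← h2]
  nlinarith [hkey, hAD, hc]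

end XWEdgeUO

end Summit.Ventures.PercRepro2
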